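import Mathlib.Analysis.SpecialFunctions.Pow.Deriv
import Literature.MeasureTheory.Hausdorff.SphereRotationInvariance
import HarnessLib

/-!
# Colding–Minicozzi's monotonicity along the paths `(s y, 1 + a s²)` for round spheres

Analytic core of Stone's value `λ(S^k) = F_{0,1}(S^k_{√(2k)})` of the Colding–Minicozzi entropy of
the self-shrinking sphere (`Literature.Geometry.Riemannian.Stone1994_cylinderEntropy`): for the
round sphere `S_r = {‖x‖ = r}` of a `(k+1)`-dimensional real inner product space `V`, a vector
`y ∈ V` and `a ∈ ℝ`, Colding–Minicozzi (2012, proof of Lemma 7.10) consider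

  `g(s) = (4π t_s)^{-k/2} ∫_{S_r} e^{-‖x - s y‖² / (4 t_s)} dμHE[k](x)`,  `t_s = 1 + a s²`,

i.e. `g(s) = F_{s y, t_s}(S_r)`, and show `g' ≤ 0` (ibid. (7.21):
`4 t_s g' = -(2s/t_s) [ |a s z^⊥ + t_s y^⊥|² ]_s`). On the sphere (where `x^⊥ = x`) and for the
self-shrinking radius `r² = 2k` this reads

  `g'(s) = -(s / (2 t_s²)) (4π t_s)^{-k/2} ∫_{S_r} (a s r + ⟪y,x⟫/r)² e^{-‖x - s y‖²/(4 t_s)} dμHE[k] ≤ 0`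

(`hasDerivAt_spherePathGaussian`, `spherePathGaussian_deriv_nonpos`). The only input about the
measure is the rotation-invariance identity `integral_sphere_exp_inner_mul_inner'`
(`SphereRotationInvariance.lean`, the sphere case of ibid. (7.16)); the rest is differentiation
under the integral sign over the finite measure `μHE[k]⌊S_r` and the pointwise algebraic identity
`spherePath_psi_eq`. Everything is written with the weight in the polynomial form
`e^{-(r² - 2s⟪y,x⟫ + s²‖y‖²)/(4 t_s)}`, which agrees with `e^{-‖x - s y‖²/(4 t_s)}` on `S_r`.

## References

* T. H. Colding, W. P. Minicozzi II, *Generic mean curvature flow I; generic singularities*,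
  Ann. of Math. 175 (2012) 755–833, §7.2, Lemma 7.10 and (7.13)–(7.21). [ColdingMinicozzi2012]
-/

noncomputable section

open Set Metric Module Filter
open _root_.MeasureTheory _root_.MeasureTheory.Measure
open scoped ENNReal NNReal Topology RealInnerProductSpace

namespace Literature.Geometry.Riemannian

/-! ### Pointwise calculus along the path -/

section Pointwise

/-- The `s`-derivative of the exponent `-(r² - 2 s X + s² Y)/(4 (1 + a s²))` of the path weight.
[cite: ColdingMinicozzi2012, (7.17)] -/
theorem hasDerivAt_spherePathExponent (a r Y X s : ℝ) (hT : 1 + a * s ^ 2 ≠ 0) :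
    HasDerivAt (fun s : ℝ ↦ -(r ^ 2 - 2 * s * X + s ^ 2 * Y) / (4 * (1 + a * s ^ 2)))
      ((X - s * Y) / (2 * (1 + a * s ^ 2)) +
        (r ^ 2 - 2 * s * X + s ^ 2 * Y) * (a * s) / (2 * (1 + a * s ^ 2) ^ 2)) s := by
  have h1 : HasDerivAt (fun s : ℝ ↦ -(r ^ 2 - 2 * s * X + s ^ 2 * Y))
      (-(-(2 * 1 * X) + (2 : ℕ) * s ^ (2 - 1) * Y)) s := by
    have hb := ((hasDerivAt_id s).const_mul (2 : ℝ)).mul_const X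
    have hc := (hasDerivAt_pow 2 s).mul_const Y
    exact ((hb.const_sub (r ^ 2)).add hc).neg
  have h2 : HasDerivAt (fun s : ℝ ↦ 4 * (1 + a * s ^ 2)) (4 * (a * ((2 : ℕ) * s ^ (2 - 1)))) s :=
    (((hasDerivAt_pow 2 s).const_mul a).const_add 1).const_mul 4
  have h4 : (4 : ℝ) * (1 + a * s ^ 2) ≠ 0 := mul_ne_zero four_ne_zero hT
  refine (h1.div h2 h4).congr_deriv ?_
  simp only [Nat.cast_ofNat, Nat.add_one_sub_one, pow_one, mul_one]
  field_simp
  ring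

/-- The `s`-derivative of the normalising factor `(4π (1 + a s²))^{-k/2}`:
`-(4π t_s)^{-k/2} · k a s / t_s`. [cite: ColdingMinicozzi2012, (7.17)] -/
theorem hasDerivAt_spherePathNormalization (k : ℕ) (a s : ℝ) (hT : 0 < 1 + a * s ^ 2) :
    HasDerivAt (fun s : ℝ ↦ (4 * Real.pi * (1 + a * s ^ 2)) ^ (-(k : ℝ) / 2))
      (-((4 * Real.pi * (1 + a * s ^ 2)) ^ (-(k : ℝ) / 2)) *
        ((k : ℝ) * a * s / (1 + a * s ^ 2))) s := by
  have hf : HasDerivAt (fun s : ℝ ↦ 4 * Real.pi * (1 + a * s ^ 2))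
      (4 * Real.pi * (a * ((2 : ℕ) * s ^ (2 - 1)))) s :=
    (((hasDerivAt_pow 2 s).const_mul a).const_add 1).const_mul (4 * Real.pi)
  have hpos : 0 < 4 * Real.pi * (1 + a * s ^ 2) := by positivity
  refine (hf.rpow_const (p := -(k : ℝ) / 2) (Or.inl hpos.ne')).congr_deriv ?_
  rw [Real.rpow_sub_one hpos.ne']
  simp only [Nat.cast_ofNat, Nat.add_one_sub_one, pow_one]
  field_simp

/-- **The pointwise identity behind `g' ≤ 0`.** With `T = 1 + a s²`, `r² = 2k`, `r ≠ 0`, `T ≠ 0`,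
the integrand `ψ = ∂_s(exponent) - k a s / T` of `(4πT)^{k/2} g'` equals
`-(s/(2T²)) (a s r + X/r)² - (1/(T r²)) [ (s/(2T)) (r² Y - X²) - k X ]`, whose last bracket
integrates to zero over the sphere by `integral_sphere_exp_inner_mul_inner'`. Here `X = ⟪y,x⟫`,
`Y = ‖y‖²`. [cite: ColdingMinicozzi2012, (7.18)–(7.21)] -/
theorem spherePath_psi_eq {k : ℕ} {a r s X Y : ℝ} (hr : r ≠ 0) (hrk : r ^ 2 = 2 * k)
    (hT : 1 + a * s ^ 2 ≠ 0) :
    (X - s * Y) / (2 * (1 + a * s ^ 2)) +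
        (r ^ 2 - 2 * s * X + s ^ 2 * Y) * (a * s) / (2 * (1 + a * s ^ 2) ^ 2) -
        (k : ℝ) * a * s / (1 + a * s ^ 2) =
      -(s / (2 * (1 + a * s ^ 2) ^ 2)) * (a * s * r + X / r) ^ 2 -
        (1 / ((1 + a * s ^ 2) * r ^ 2)) *
          ((s / (2 * (1 + a * s ^ 2))) * (r ^ 2 * Y - X ^ 2) - (k : ℝ) * X) := by
  have hk : (k : ℝ) = r ^ 2 / 2 := by rw [hrk]; ring
  generalize hTdef : 1 + a * s ^ 2 = T at hT ⊢
  rw [hk]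
  field_simp
  subst hTdef
  ring

end Pointwise

/-! ### Integrability on spheres -/

variable {V : Type*} [NormedAddCommGroup V] [InnerProductSpace ℝ V] [FiniteDimensional ℝ V]
  [MeasurableSpace V] [BorelSpace V]

/-- A continuous function is integrable on a round sphere for `μHE[k]` (`dim V = k + 1`): it is
bounded there and the sphere has finite measure. [folklore] -/
theorem integrableOn_sphere_of_continuous {k : ℕ} (hV : finrank ℝ V = k + 1) (r : ℝ)
    {G : V → ℝ} (hG : Continuous G) : IntegrableOn G (sphere (0 : V) r) (μHE[k] : Measure V) := by
  obtain ⟨M, hM⟩ := (isCompact_sphere (0 : V) r).exists_bound_of_continuousOn hG.continuousOn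
  exact Measure.integrableOn_of_bounded (M := M)
    (MeasureTheory.Hausdorff.euclideanHausdorffMeasure_sphere_lt_top hV r).ne hG.aestronglyMeasurable
    ((ae_restrict_iff' isClosed_sphere.measurableSet).2 (ae_of_all _ fun x hx ↦ hM x hx))

/-! ### Differentiating the path integral -/

/-- **Differentiation under the integral sign along the path.** For `t_{s₀} = 1 + a s₀² > 0`,
`s ↦ ∫_{S_r} e^{-(r² - 2s⟪y,x⟫ + s²‖y‖²)/(4 t_s)} dμHE[k]` is differentiable at `s₀` with derivative
the integral of the `s`-derivative of the integrand (finite measure, integrand smooth in `s`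
with derivative bounded uniformly for `x` on the sphere and `s` near `s₀`).
[cite: ColdingMinicozzi2012, (7.17)] -/
theorem hasDerivAt_integral_spherePathWeight {k : ℕ} (hV : finrank ℝ V = k + 1) (y : V) (a r : ℝ)
    {s₀ : ℝ} (hs₀ : 0 < 1 + a * s₀ ^ 2) :
    HasDerivAt (fun s : ℝ ↦ ∫ x in sphere (0 : V) r,
        Real.exp (-(r ^ 2 - 2 * s * ⟪y, x⟫ + s ^ 2 * ‖y‖ ^ 2) / (4 * (1 + a * s ^ 2)))
          ∂(μHE[k] : Measure V))
      (∫ x in sphere (0 : V) r,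
        Real.exp (-(r ^ 2 - 2 * s₀ * ⟪y, x⟫ + s₀ ^ 2 * ‖y‖ ^ 2) / (4 * (1 + a * s₀ ^ 2))) *
          ((⟪y, x⟫ - s₀ * ‖y‖ ^ 2) / (2 * (1 + a * s₀ ^ 2)) +
            (r ^ 2 - 2 * s₀ * ⟪y, x⟫ + s₀ ^ 2 * ‖y‖ ^ 2) * (a * s₀) / (2 * (1 + a * s₀ ^ 2) ^ 2))
          ∂(μHE[k] : Measure V)) s₀ := by
  set σ : Measure V := (μHE[k] : Measure V).restrict (sphere 0 r) with hσ_def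
  haveI : IsFiniteMeasure σ := ⟨by
    rw [hσ_def, Measure.restrict_apply_univ]
    exact MeasureTheory.Hausdorff.euclideanHausdorffMeasure_sphere_lt_top hV r⟩
  -- the integrand and its `s`-derivative as functions of `(s, X)`, `X = ⟪y, x⟫`
  set q : ℝ → ℝ → ℝ := fun s X ↦ -(r ^ 2 - 2 * s * X + s ^ 2 * ‖y‖ ^ 2) / (4 * (1 + a * s ^ 2))
    with hq_def
  set φ : ℝ → ℝ → ℝ := fun s X ↦ (X - s * ‖y‖ ^ 2) / (2 * (1 + a * s ^ 2)) +
      (r ^ 2 - 2 * s * X + s ^ 2 * ‖y‖ ^ 2) * (a * s) / (2 * (1 + a * s ^ 2) ^ 2) with hφ_def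
  -- a neighbourhood of `s₀` on which `t_s > 0`
  have hTc : Continuous fun s : ℝ ↦ 1 + a * s ^ 2 := by fun_prop
  have hev : ∀ᶠ s in 𝓝 s₀, 0 < 1 + a * s ^ 2 := hTc.continuousAt.eventually (lt_mem_nhds hs₀)
  obtain ⟨ε, hε, hball⟩ := Metric.eventually_nhds_iff_ball.1 hev
  have hε2 : 0 < ε / 2 := half_pos hε
  have hclosed : ∀ s ∈ closedBall s₀ (ε / 2), 0 < 1 + a * s ^ 2 := fun s hs ↦
    hball s (closedBall_subset_ball (half_lt_self hε) hs)
  -- continuity of the derivative integrand in `(s, X)` where `t_s ≠ 0`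
  set Φ : ℝ × ℝ → ℝ := fun p ↦ Real.exp (q p.1 p.2) * φ p.1 p.2 with hΦ_def
  have hΦ : ∀ p : ℝ × ℝ, 1 + a * p.1 ^ 2 ≠ 0 → ContinuousAt Φ p := by
    intro p hp
    have h4 : 4 * (1 + a * p.1 ^ 2) ≠ 0 := mul_ne_zero four_ne_zero hp
    have h2 : 2 * (1 + a * p.1 ^ 2) ≠ 0 := mul_ne_zero two_ne_zero hp
    have h2' : 2 * (1 + a * p.1 ^ 2) ^ 2 ≠ 0 := mul_ne_zero two_ne_zero (pow_ne_zero 2 hp)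
    simp only [hΦ_def, hq_def, hφ_def]
    apply ContinuousAt.mul
    · apply ContinuousAt.rexp
      exact ContinuousAt.div (by fun_prop) (by fun_prop) h4
    · apply ContinuousAt.add
      · exact ContinuousAt.div (by fun_prop) (by fun_prop) h2
      · exact ContinuousAt.div (by fun_prop) (by fun_prop) h2'
  -- a uniform bound on the compact set `closedBall s₀ (ε/2) × [-M, M]`
  set M : ℝ := ‖y‖ * |r| with hM_def
  have hXM : ∀ x ∈ sphere (0 : V) r, ⟪y, x⟫ ∈ Icc (-M) M := by
    intro x hx
    have h := abs_real_inner_le_norm y x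
    rw [mem_sphere_zero_iff_norm.1 hx] at h
    have h' : |⟪y, x⟫| ≤ M := h.trans (by rw [hM_def]; exact mul_le_mul_of_nonneg_left (le_abs_self r) (norm_nonneg y))
    exact ⟨neg_le_of_abs_le h', le_of_abs_le h'⟩
  have hKc : IsCompact (closedBall s₀ (ε / 2) ×ˢ Icc (-M) M) :=
    (isCompact_closedBall _ _).prod isCompact_Icc
  have hΦc : ContinuousOn Φ (closedBall s₀ (ε / 2) ×ˢ Icc (-M) M) := by
    refine continuousOn_of_forall_continuousAt fun p hp ↦ hΦ p ?_
    exact (hclosed p.1 (mem_prod.1 hp).1).ne'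
  obtain ⟨C, hC⟩ := hKc.exists_bound_of_continuousOn hΦc
  -- apply the dominated differentiation lemma
  have hcont : ∀ s, Continuous fun x : V ↦ Real.exp (q s ⟪y, x⟫) := fun s ↦ by
    simp only [hq_def]; fun_prop
  have hcont' : ∀ s, Continuous fun x : V ↦ Real.exp (q s ⟪y, x⟫) * φ s ⟪y, x⟫ := fun s ↦ by
    simp only [hq_def, hφ_def]; fun_prop
  have key := hasDerivAt_integral_of_dominated_loc_of_deriv_le (μ := σ) (x₀ := s₀)
    (F := fun s x ↦ Real.exp (q s ⟪y, x⟫)) (F' := fun s x ↦ Real.exp (q s ⟪y, x⟫) * φ s ⟪y, x⟫)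
    (s := ball s₀ (ε / 2)) (bound := fun _ ↦ C) (ball_mem_nhds _ hε2)
    (Eventually.of_forall fun s ↦ (hcont s).aestronglyMeasurable)
    (integrableOn_sphere_of_continuous hV r (hcont s₀))
    (hcont' s₀).aestronglyMeasurable ?_ (integrable_const _) ?_
  · exact key.2
  · refine (ae_restrict_iff' isClosed_sphere.measurableSet).2 (ae_of_all _ fun x hx s hs ↦ ?_)
    have hmem : (s, ⟪y, x⟫) ∈ closedBall s₀ (ε / 2) ×ˢ Icc (-M) M :=
      mem_prod.2 ⟨ball_subset_closedBall hs, hXM x hx⟩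
    exact hC _ hmem
  · refine ae_of_all _ fun x s hs ↦ ?_
    have hT : 1 + a * s ^ 2 ≠ 0 := (hclosed s (ball_subset_closedBall hs)).ne'
    exact (hasDerivAt_spherePathExponent a r (‖y‖ ^ 2) ⟪y, x⟫ s hT).exp

/-- **The derivative of Colding–Minicozzi's path functional for the round sphere.** With
`t_s = 1 + a s²` and `g(s) = (4π t_s)^{-k/2} ∫_{S_r} e^{-(r² - 2s⟪y,x⟫ + s²‖y‖²)/(4 t_s)} dμHE[k]`,
at every `s` with `t_s > 0`:
`g'(s) = (4π t_s)^{-k/2} ∫_{S_r} e^{…} · ψ`, `ψ = ∂_s(exponent) - k a s/t_s`.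
[cite: ColdingMinicozzi2012, (7.17)] -/
theorem hasDerivAt_spherePathGaussian_psi {k : ℕ} (hV : finrank ℝ V = k + 1) (y : V) (a r : ℝ)
    {s : ℝ} (hs : 0 < 1 + a * s ^ 2) :
    HasDerivAt (fun s : ℝ ↦ (4 * Real.pi * (1 + a * s ^ 2)) ^ (-(k : ℝ) / 2) *
        ∫ x in sphere (0 : V) r,
          Real.exp (-(r ^ 2 - 2 * s * ⟪y, x⟫ + s ^ 2 * ‖y‖ ^ 2) / (4 * (1 + a * s ^ 2)))
            ∂(μHE[k] : Measure V))
      ((4 * Real.pi * (1 + a * s ^ 2)) ^ (-(k : ℝ) / 2) *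
        ∫ x in sphere (0 : V) r,
          Real.exp (-(r ^ 2 - 2 * s * ⟪y, x⟫ + s ^ 2 * ‖y‖ ^ 2) / (4 * (1 + a * s ^ 2))) *
            ((⟪y, x⟫ - s * ‖y‖ ^ 2) / (2 * (1 + a * s ^ 2)) +
              (r ^ 2 - 2 * s * ⟪y, x⟫ + s ^ 2 * ‖y‖ ^ 2) * (a * s) / (2 * (1 + a * s ^ 2) ^ 2) -
              (k : ℝ) * a * s / (1 + a * s ^ 2))
          ∂(μHE[k] : Measure V)) s := by
  have hN := hasDerivAt_spherePathNormalization k a s hs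
  have hI := hasDerivAt_integral_spherePathWeight hV y a r hs
  refine (hN.mul hI).congr_deriv ?_
  -- rearrange `N' I + N I'` into `N ∫ e ψ`
  set N : ℝ := (4 * Real.pi * (1 + a * s ^ 2)) ^ (-(k : ℝ) / 2) with hN_def
  set c : ℝ := (k : ℝ) * a * s / (1 + a * s ^ 2) with hc_def
  have he : Continuous fun x : V ↦
      Real.exp (-(r ^ 2 - 2 * s * ⟪y, x⟫ + s ^ 2 * ‖y‖ ^ 2) / (4 * (1 + a * s ^ 2))) := by fun_prop
  have heφ : Continuous fun x : V ↦
      Real.exp (-(r ^ 2 - 2 * s * ⟪y, x⟫ + s ^ 2 * ‖y‖ ^ 2) / (4 * (1 + a * s ^ 2))) *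
        ((⟪y, x⟫ - s * ‖y‖ ^ 2) / (2 * (1 + a * s ^ 2)) +
          (r ^ 2 - 2 * s * ⟪y, x⟫ + s ^ 2 * ‖y‖ ^ 2) * (a * s) / (2 * (1 + a * s ^ 2) ^ 2)) := by
    fun_prop
  have hi1 := integrableOn_sphere_of_continuous hV r heφ
  have hsplit : ∫ x in sphere (0 : V) r,
      Real.exp (-(r ^ 2 - 2 * s * ⟪y, x⟫ + s ^ 2 * ‖y‖ ^ 2) / (4 * (1 + a * s ^ 2))) *
        ((⟪y, x⟫ - s * ‖y‖ ^ 2) / (2 * (1 + a * s ^ 2)) +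
          (r ^ 2 - 2 * s * ⟪y, x⟫ + s ^ 2 * ‖y‖ ^ 2) * (a * s) / (2 * (1 + a * s ^ 2) ^ 2) - c)
        ∂(μHE[k] : Measure V) =
      (∫ x in sphere (0 : V) r,
        Real.exp (-(r ^ 2 - 2 * s * ⟪y, x⟫ + s ^ 2 * ‖y‖ ^ 2) / (4 * (1 + a * s ^ 2))) *
          ((⟪y, x⟫ - s * ‖y‖ ^ 2) / (2 * (1 + a * s ^ 2)) +
            (r ^ 2 - 2 * s * ⟪y, x⟫ + s ^ 2 * ‖y‖ ^ 2) * (a * s) / (2 * (1 + a * s ^ 2) ^ 2))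
          ∂(μHE[k] : Measure V)) -
        c * ∫ x in sphere (0 : V) r,
          Real.exp (-(r ^ 2 - 2 * s * ⟪y, x⟫ + s ^ 2 * ‖y‖ ^ 2) / (4 * (1 + a * s ^ 2)))
            ∂(μHE[k] : Measure V) := by
    have hi2 : IntegrableOn (fun x : V ↦ c *
        Real.exp (-(r ^ 2 - 2 * s * ⟪y, x⟫ + s ^ 2 * ‖y‖ ^ 2) / (4 * (1 + a * s ^ 2))))
        (sphere (0 : V) r) (μHE[k] : Measure V) :=
      integrableOn_sphere_of_continuous hV r (by fun_prop)
    rw [← integral_const_mul, ← integral_sub hi1 hi2]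
    refine integral_congr_ae (ae_of_all _ fun x ↦ ?_)
    ring
  rw [hsplit, hc_def]
  ring

/-- **`g' = -(s/(2 t_s²)) (4π t_s)^{-k/2} ∫ (a s r + ⟪y,x⟫/r)² e^{…}`** for the self-shrinking
radius `r² = 2k` (`r ≠ 0`, `t_s > 0`): the integral of `e^{…} ψ` equals
`-(s/(2t_s²)) ∫ (a s r + ⟪y,x⟫/r)² e^{…}`, because the remaining part of `ψ` integrates to zero by
the rotation-invariance identity `integral_sphere_exp_inner_mul_inner'`. This is the sphere case
of Colding–Minicozzi 2012, (7.21). [cite: ColdingMinicozzi2012, (7.21)] -/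
theorem integral_spherePathWeight_mul_psi {k : ℕ} (hV : finrank ℝ V = k + 1) (y : V) {a r s : ℝ}
    (hr : r ≠ 0) (hrk : r ^ 2 = 2 * k) (hT : 1 + a * s ^ 2 ≠ 0) :
    ∫ x in sphere (0 : V) r,
        Real.exp (-(r ^ 2 - 2 * s * ⟪y, x⟫ + s ^ 2 * ‖y‖ ^ 2) / (4 * (1 + a * s ^ 2))) *
          ((⟪y, x⟫ - s * ‖y‖ ^ 2) / (2 * (1 + a * s ^ 2)) +
            (r ^ 2 - 2 * s * ⟪y, x⟫ + s ^ 2 * ‖y‖ ^ 2) * (a * s) / (2 * (1 + a * s ^ 2) ^ 2) -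
            (k : ℝ) * a * s / (1 + a * s ^ 2))
        ∂(μHE[k] : Measure V) =
      -(s / (2 * (1 + a * s ^ 2) ^ 2)) * ∫ x in sphere (0 : V) r,
        Real.exp (-(r ^ 2 - 2 * s * ⟪y, x⟫ + s ^ 2 * ‖y‖ ^ 2) / (4 * (1 + a * s ^ 2))) *
          (a * s * r + ⟪y, x⟫ / r) ^ 2 ∂(μHE[k] : Measure V) := by
  set T : ℝ := 1 + a * s ^ 2 with hT_def
  set α : ℝ := -(r ^ 2 + s ^ 2 * ‖y‖ ^ 2) / (4 * T) with hα_def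
  set β : ℝ := s / (2 * T) with hβ_def
  have h4 : (4 : ℝ) * T ≠ 0 := mul_ne_zero four_ne_zero hT
  -- the weight in the form `e^{α + β⟪y,x⟫}`
  have hw : ∀ x : V, Real.exp (-(r ^ 2 - 2 * s * ⟪y, x⟫ + s ^ 2 * ‖y‖ ^ 2) / (4 * T)) =
      Real.exp (α + β * ⟪y, x⟫) := by
    intro x
    congr 1
    rw [hα_def, hβ_def]
    field_simp
    ring
  -- pointwise rewriting of `ψ`
  have hψ : ∀ x : V,
      Real.exp (-(r ^ 2 - 2 * s * ⟪y, x⟫ + s ^ 2 * ‖y‖ ^ 2) / (4 * T)) *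
          ((⟪y, x⟫ - s * ‖y‖ ^ 2) / (2 * T) +
            (r ^ 2 - 2 * s * ⟪y, x⟫ + s ^ 2 * ‖y‖ ^ 2) * (a * s) / (2 * T ^ 2) -
            (k : ℝ) * a * s / T) =
        -(s / (2 * T ^ 2)) * (Real.exp (α + β * ⟪y, x⟫) * (a * s * r + ⟪y, x⟫ / r) ^ 2) -
          (1 / (T * r ^ 2)) * (β * ((r ^ 2 * ‖y‖ ^ 2 - ⟪y, x⟫ ^ 2) * Real.exp (α + β * ⟪y, x⟫)) -
            (k : ℝ) * (⟪y, x⟫ * Real.exp (α + β * ⟪y, x⟫))) := by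
    intro x
    rw [hw x, spherePath_psi_eq (X := ⟪y, x⟫) (Y := ‖y‖ ^ 2) hr hrk hT, ← hβ_def]
    ring
  have hψ' : ∀ x : V,
      Real.exp (-(r ^ 2 - 2 * s * ⟪y, x⟫ + s ^ 2 * ‖y‖ ^ 2) / (4 * T)) * (a * s * r + ⟪y, x⟫ / r) ^ 2 =
        Real.exp (α + β * ⟪y, x⟫) * (a * s * r + ⟪y, x⟫ / r) ^ 2 := fun x ↦ by rw [hw x]
  simp_rw [hψ, hψ']
  -- integrability of the pieces
  have hi1 : IntegrableOn (fun x : V ↦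
      -(s / (2 * T ^ 2)) * (Real.exp (α + β * ⟪y, x⟫) * (a * s * r + ⟪y, x⟫ / r) ^ 2))
      (sphere (0 : V) r) (μHE[k] : Measure V) := integrableOn_sphere_of_continuous hV r (by fun_prop)
  have hi2 : IntegrableOn (fun x : V ↦
      β * ((r ^ 2 * ‖y‖ ^ 2 - ⟪y, x⟫ ^ 2) * Real.exp (α + β * ⟪y, x⟫)))
      (sphere (0 : V) r) (μHE[k] : Measure V) := integrableOn_sphere_of_continuous hV r (by fun_prop)
  have hi3 : IntegrableOn (fun x : V ↦ (k : ℝ) * (⟪y, x⟫ * Real.exp (α + β * ⟪y, x⟫)))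
      (sphere (0 : V) r) (μHE[k] : Measure V) := integrableOn_sphere_of_continuous hV r (by fun_prop)
  have hi23 : IntegrableOn (fun x : V ↦ (1 / (T * r ^ 2)) *
      (β * ((r ^ 2 * ‖y‖ ^ 2 - ⟪y, x⟫ ^ 2) * Real.exp (α + β * ⟪y, x⟫)) -
        (k : ℝ) * (⟪y, x⟫ * Real.exp (α + β * ⟪y, x⟫))))
      (sphere (0 : V) r) (μHE[k] : Measure V) := integrableOn_sphere_of_continuous hV r (by fun_prop)
  rw [integral_sub hi1 hi23, integral_const_mul, integral_const_mul, integral_sub hi2 hi3,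
    integral_const_mul, integral_const_mul,
    MeasureTheory.Hausdorff.integral_sphere_exp_inner_mul_inner' hV y r α β, sub_self, mul_zero,
    sub_zero]

/-- **Colding–Minicozzi monotonicity for the self-shrinking sphere**: for `r² = 2k`, `r ≠ 0`,
`s ≥ 0` and `t_s = 1 + a s² > 0`, the derivative of
`g(s) = (4π t_s)^{-k/2} ∫_{S_r} e^{-(r² - 2s⟪y,x⟫ + s²‖y‖²)/(4t_s)} dμHE[k]` is
`-(4π t_s)^{-k/2} (s/(2t_s²)) ∫_{S_r} (a s r + ⟪y,x⟫/r)² e^{…} ≤ 0` (Colding–Minicozzi 2012,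
(7.21): "This is clearly non-positive"). [cite: ColdingMinicozzi2012, Lemma 7.10] -/
theorem hasDerivAt_spherePathGaussian {k : ℕ} (hV : finrank ℝ V = k + 1) (y : V) {a r s : ℝ}
    (hr : r ≠ 0) (hrk : r ^ 2 = 2 * k) (hs : 0 < 1 + a * s ^ 2) :
    HasDerivAt (fun s : ℝ ↦ (4 * Real.pi * (1 + a * s ^ 2)) ^ (-(k : ℝ) / 2) *
        ∫ x in sphere (0 : V) r,
          Real.exp (-(r ^ 2 - 2 * s * ⟪y, x⟫ + s ^ 2 * ‖y‖ ^ 2) / (4 * (1 + a * s ^ 2)))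
            ∂(μHE[k] : Measure V))
      ((4 * Real.pi * (1 + a * s ^ 2)) ^ (-(k : ℝ) / 2) *
        (-(s / (2 * (1 + a * s ^ 2) ^ 2)) * ∫ x in sphere (0 : V) r,
          Real.exp (-(r ^ 2 - 2 * s * ⟪y, x⟫ + s ^ 2 * ‖y‖ ^ 2) / (4 * (1 + a * s ^ 2))) *
            (a * s * r + ⟪y, x⟫ / r) ^ 2 ∂(μHE[k] : Measure V))) s := by
  have h := hasDerivAt_spherePathGaussian_psi hV y a r hs
  rwa [integral_spherePathWeight_mul_psi hV y hr hrk hs.ne'] at h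

omit [FiniteDimensional ℝ V] in
/-- The derivative in `hasDerivAt_spherePathGaussian` is `≤ 0` for `s ≥ 0`.
[cite: ColdingMinicozzi2012, Lemma 7.10] -/
theorem spherePathGaussian_deriv_nonpos {k : ℕ} (y : V) {a r s : ℝ} (hs0 : 0 ≤ s)
    (hs : 0 < 1 + a * s ^ 2) :
    (4 * Real.pi * (1 + a * s ^ 2)) ^ (-(k : ℝ) / 2) *
        (-(s / (2 * (1 + a * s ^ 2) ^ 2)) * ∫ x in sphere (0 : V) r,
          Real.exp (-(r ^ 2 - 2 * s * ⟪y, x⟫ + s ^ 2 * ‖y‖ ^ 2) / (4 * (1 + a * s ^ 2))) *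
            (a * s * r + ⟪y, x⟫ / r) ^ 2 ∂(μHE[k] : Measure V)) ≤ 0 := by
  have hN : 0 ≤ (4 * Real.pi * (1 + a * s ^ 2)) ^ (-(k : ℝ) / 2) :=
    Real.rpow_nonneg (by positivity) _
  have hI : 0 ≤ ∫ x in sphere (0 : V) r,
      Real.exp (-(r ^ 2 - 2 * s * ⟪y, x⟫ + s ^ 2 * ‖y‖ ^ 2) / (4 * (1 + a * s ^ 2))) *
        (a * s * r + ⟪y, x⟫ / r) ^ 2 ∂(μHE[k] : Measure V) :=
    integral_nonneg fun x ↦ mul_nonneg (Real.exp_pos _).le (sq_nonneg _)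
  have hc : 0 ≤ s / (2 * (1 + a * s ^ 2) ^ 2) := by positivity
  have : -(s / (2 * (1 + a * s ^ 2) ^ 2)) * (∫ x in sphere (0 : V) r,
      Real.exp (-(r ^ 2 - 2 * s * ⟪y, x⟫ + s ^ 2 * ‖y‖ ^ 2) / (4 * (1 + a * s ^ 2))) *
        (a * s * r + ⟪y, x⟫ / r) ^ 2 ∂(μHE[k] : Measure V)) ≤ 0 := by
    rw [neg_mul]
    exact neg_nonpos.2 (mul_nonneg hc hI)
  exact mul_nonpos_of_nonneg_of_nonpos hN this

end Literature.Geometry.Riemannian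

end
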